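import Literature.MathematicalPhysics.QuantumLattice.FermiTimeKernelDetBound
import Literature.MathematicalPhysics.QuantumLattice.HubbardShiftedCovarianceDecomposition
import Literature.MathematicalPhysics.QuantumLattice.HubbardShiftedSliceSymbolDifferences
import Literature.MathematicalPhysics.QuantumLattice.HubbardGridPropagatorGram
import Literature.MathematicalPhysics.QuantumLattice.GrassmannDeterminantBounded
import Literature.Analysis.Matrix.DetRowIntegral
import HarnessLib

/-!
# The Pedra–Salmhofer determinant bound for the ultraviolet block of the shifted Hubbard covariance on the time grid

Topic `MathematicalPhysics/QuantumLattice`; the Matsubara-UV step of the cell gate-hubbard-kl (R0, ARCH-β P3e).  The ultraviolet block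
`C_uv = hubbardCovUVShifted β μ θ Λ₀` (symbol `(χ_n - 1 + w_{Λ₀}(k)) βL²/(-i(ω+θ)+ξ)`, `χ_n = 1 - |n|/M` the Fejér top weight) pulled
back to the position–time fields on the grid `{jβ/N} × (ℤ/L)²` (`hubbardGridSub`) satisfies the replica-stable determinant bound
**`isDetBoundedR_gridSub_hubbardCovUVShifted`**:

`IsDetBoundedR q (Sᵀ C_uv S) (2 √(1 + κ²))`,

`κ` any bound of the Gram vectors of the infrared part `(1 - w_{Λ₀}) βL²/(-i(ω+θ)+ξ)` — uniformly in the Matsubara cutoff `M`, the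
grid `N`, the volume `L` and the temperature: de Siqueira Pedra–Salmhofer 2008, Thm 2.4 (determinant bound `2γ δ_C`, no `log M`),
here through the row-average identity `integral_freqKernel_mul_fermiTimeKernel` (the Fejér-weighted frequency sum of the propagator
is the average `∫₀^β F_χ(τ - s) K_β(ξ - iθ; s, τ′) ds` of the chronological kernel against the Fejér kernel, `∫|F_χ| = 1`), the
frozen-time bound `norm_det_fermiTimeKernel_add_gram_le` and the row-integral expansion `norm_det_row_integral_le`.

* `integral_norm_freqKernel_fejer_sub` — translation invariance of `∫₀^β |F_χ(τ - s)| ds = 1`;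
* `sum_freq_top_symbol_phase_eq_integral`, `gridSub_pullback_top_apply` — the Fejér-truncated propagator between grid points as a
  time average of the chronological kernel;
* `hubbardCovUVShifted_eq_sub`, `contr_gridSub_pullback_uv_eq` — `contr (Sᵀ C_uv S) = -(Sᵀ C_χ S) - ⟪F, G⟫` (IR part in Gram form);
* **`isDetBoundedR_gridSub_hubbardCovUVShifted`**.

Everything is PROVED; no definitions, no named facts.

## Sources

W. de Siqueira Pedra, M. Salmhofer, Comm. Math. Phys. 282 (2008) 797–818, Thm 2.4, §2 (2.8)–(2.10), §4.1 [`PedraSalmhofer2008`];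
G. Benfatto, A. Giuliani, V. Mastropietro, Ann. Henri Poincaré 7 (2006) 809–898, §2.2 (2.10), App. A1 [`BenfattoGiulianiMastropietro2006`].
-/

noncomputable section

open Finset Set MeasureTheory

open scoped InnerProductSpace ComplexConjugate

namespace Literature.MathematicalPhysics.QuantumLattice

open Literature.Probability.LatticeModels GrassmannAlgebra

/-! ### The Fejér kernel: continuity and translation invariance of its `L¹` norm -/

section Fejer

variable {ι : Type*} [Fintype ι]

/-- The synthesis kernel is continuous. [cite: PedraSalmhofer2008, §2 (2.8)] -/
theorem continuous_freqKernel (β : ℝ) (ω : ι → ℝ) (c : ι → ℂ) : Continuous (freqKernel β ω c) := by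
  unfold freqKernel
  exact continuous_const.mul (continuous_finsetSum _ fun n _ => continuous_const.mul (Complex.continuous_exp.comp
    ((Complex.continuous_ofReal.comp (continuous_const.mul continuous_id)).mul continuous_const)))

/-- **Translation invariance of the Fejér weight**: `∫₀^β |F_χ(τ - s)| ds = 1` for every real `τ` (`|F_χ|` is `β`-periodic).
[cite: PedraSalmhofer2008, §2 (2.8)] -/
theorem integral_norm_freqKernel_fejer_sub {β : ℝ} (hβ : 0 < β) {M : ℕ} (hM : 0 < M) (τ : ℝ) :
    ∫ s in (0:ℝ)..β, ‖freqKernel β (matsubaraFreq β M) (fun i => ((fejerWeight M (matsubaraInt M i) : ℝ) : ℂ)) (τ - s)‖ = 1 := by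
  set f : ℝ → ℝ := fun s => ‖freqKernel β (matsubaraFreq β M) (fun i => ((fejerWeight M (matsubaraInt M i) : ℝ) : ℂ)) s‖
    with hf
  have hβ' : (β : ℂ) ≠ 0 := by exact_mod_cast hβ.ne'
  have hper : Function.Periodic f β := by
    intro s
    simp only [hf, norm_freqKernel_fejer_eq hβ hM]
    rw [show (∑ j ∈ range M, Complex.exp (((2 * Real.pi * j * (s + β) / β : ℝ) : ℂ) * Complex.I)) =
        ∑ j ∈ range M, Complex.exp (((2 * Real.pi * j * s / β : ℝ) : ℂ) * Complex.I) from sum_congr rfl fun j _ => by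
      rw [show ((2 * Real.pi * j * (s + β) / β : ℝ) : ℂ) * Complex.I =
          ((2 * Real.pi * j * s / β : ℝ) : ℂ) * Complex.I + (j : ℕ) * (2 * Real.pi * Complex.I) by
        push_cast; field_simp, Complex.exp_add, Complex.exp_nat_mul_two_pi_mul_I, mul_one]]
  change ∫ s in (0:ℝ)..β, f (τ - s) = 1
  rw [intervalIntegral.integral_comp_sub_left (fun s => f s) τ, sub_zero,
    show (∫ s in τ - β..τ, f s) = ∫ s in (τ - β)..(τ - β) + β, f s by rw [sub_add_cancel],
    hper.intervalIntegral_add_eq (τ - β) 0, zero_add]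
  exact integral_norm_freqKernel_fejer hβ hM

/-- The chronological kernel is interval-integrable in `σ` on `[0, β]`. [cite: PedraSalmhofer2008, §4.1] -/
theorem intervalIntegrable_fermiTimeKernel {β : ℝ} (E : ℂ) {t : ℝ} (ht : t ∈ Icc 0 β) :
    IntervalIntegrable (fun σ => fermiTimeKernel β E σ t) volume 0 β := by
  obtain ⟨h1, h2⟩ := intervalIntegrable_fermiTimeKernel_mul (β := β) E 0 ht
  have h := h1.trans h2
  simp only [zero_mul, Complex.exp_zero, one_mul] at h
  exact h

end Fejer

/-! ### The Fejér-truncated propagator between grid points as a time average -/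

section Average

variable {L M : ℕ} [NeZero L]

/-- The grid times lie in `[0, β]`. [cite: Salmhofer1999, §4.2.4 (4.55)] -/
theorem gridTime_mem_Icc {β : ℝ} (hβ : 0 ≤ β) {N : ℕ} (j : Fin N) : gridTime β N j ∈ Icc 0 β := by
  have hN : 0 < N := Fin.pos j
  have hN' : (0 : ℝ) < N := by exact_mod_cast hN
  refine ⟨by unfold gridTime; positivity, ?_⟩
  rw [gridTime, div_le_iff₀ hN']
  have hj : (j : ℝ) ≤ N := by exact_mod_cast (Fin.is_lt j).le
  nlinarith

/-- `E - iω_n ≠ 0` for `E = ξ - iθ`, `|βθ| ≤ π/4`: the shift never reaches a fermionic frequency (`|ω_n| ≥ π/β`).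
[cite: BenfattoGiulianiMastropietro2006, §2.1 (2.3)] -/
theorem shift_sub_matsubaraFreq_ne_zero {β : ℝ} (hβ : 0 < β) {θ : ℝ} (hθ : |β * θ| ≤ Real.pi / 4) (ξ : ℝ)
    (i : MatsubaraIdx M) :
    ((ξ : ℂ) - (θ : ℂ) * Complex.I) - (matsubaraFreq β M i : ℂ) * Complex.I ≠ 0 := by
  intro h
  have him := congrArg Complex.im h
  simp only [Complex.sub_im, Complex.ofReal_im, Complex.mul_im, Complex.ofReal_re, Complex.I_im, Complex.I_re,
    Complex.zero_im, mul_one, mul_zero, add_zero, zero_sub] at him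
  have hω := pi_div_le_abs_matsubaraFreq hβ i
  have h1 : |β * θ| = β * |θ| := by rw [abs_mul, abs_of_pos hβ]
  have h2 : β * |matsubaraFreq β M i| ≥ Real.pi := by
    have := mul_le_mul_of_nonneg_left hω hβ.le
    rwa [mul_div_cancel₀ _ hβ.ne'] at this
  have h3 : |θ| = |matsubaraFreq β M i| := by
    rw [show θ = -matsubaraFreq β M i by linarith, abs_neg]
  nlinarith [Real.pi_pos, abs_nonneg θ]

/-- `(ω_n + θ)² + ξ² ≠ 0` under the same hypothesis. [cite: BenfattoGiulianiMastropietro2006, §2.1 (2.3)] -/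
theorem matsubara_shift_den_ne_zero {β : ℝ} (hβ : 0 < β) {θ : ℝ} (hθ : |β * θ| ≤ Real.pi / 4) (ξ : ℝ)
    (i : MatsubaraIdx M) : (matsubaraFreq β M i + θ) ^ 2 + ξ ^ 2 ≠ 0 := by
  intro h
  have h0 : matsubaraFreq β M i + θ = 0 := by nlinarith [sq_nonneg (matsubaraFreq β M i + θ), sq_nonneg ξ]
  have hω := pi_div_le_abs_matsubaraFreq hβ i
  have h1 : |β * θ| = β * |θ| := by rw [abs_mul, abs_of_pos hβ]
  have h2 : β * |matsubaraFreq β M i| ≥ Real.pi := by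
    have := mul_le_mul_of_nonneg_left hω hβ.le
    rwa [mul_div_cancel₀ _ hβ.ne'] at this
  have h3 : |θ| = |matsubaraFreq β M i| := by
    rw [show θ = -matsubaraFreq β M i by linarith, abs_neg]
  nlinarith [Real.pi_pos, abs_nonneg θ]

/-- **The Fejér-weighted frequency sum of the shifted propagator at fixed spatial momentum is a time average of the chronological
kernel**: `Σ_n (βL²)⁻² e^{i(k·x_a - k·x_b)} χ_n p_θ(n, k⃗) = L⁻² e^{ip⃗(x⃗_a - x⃗_b)} ∫₀^β F_χ(τ_a - s) K_β(ξ_k⃗ - iθ; s, τ_b) ds`.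
[cite: PedraSalmhofer2008, §2 (2.8)-(2.10)] -/
theorem sum_freq_top_symbol_phase_eq_integral {β : ℝ} (hβ : 0 < β) {θ : ℝ} (hθ : |β * θ| ≤ Real.pi / 4) (μ : ℝ)
    (kv : TorusSite 2 L) (σ : Fin 2) (xa xb : TorusSite 2 L) (τa : ℝ) {τb : ℝ} (hτb : τb ∈ Icc 0 β) :
    ∑ i : MatsubaraIdx M, ((1 / (β * (L : ℝ) ^ 2) : ℝ) : ℂ) ^ 2 *
        (Complex.exp (((vertexPhase L M β (i, kv) xa τa - vertexPhase L M β (i, kv) xb τb : ℝ) : ℂ) * Complex.I) *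
          (((topWeight L M (i, kv) : ℝ) : ℂ) * shiftedFreeSymbol L M β μ θ ((i, kv), σ))) =
      ((1 / (L : ℝ) : ℝ) : ℂ) * Complex.exp (((∑ l, latticeMomentum L kv l * ((xa l).val : ℝ) : ℝ) : ℂ) * Complex.I) *
          (((1 / (L : ℝ) : ℝ) : ℂ) * Complex.exp (-(((∑ l, latticeMomentum L kv l * ((xb l).val : ℝ) : ℝ) : ℂ) * Complex.I))) *
        ∫ s in (0:ℝ)..β, freqKernel β (matsubaraFreq β M) (fun i => ((fejerWeight M (matsubaraInt M i) : ℝ) : ℂ)) (τa - s) *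
          fermiTimeKernel β ((nambuXi L μ kv : ℂ) - (θ : ℂ) * Complex.I) s τb := by
  have hω : ∀ i : MatsubaraIdx M, Complex.exp (-(((matsubaraFreq β M i * β : ℝ) : ℂ) * Complex.I)) = -1 :=
    fun i => exp_neg_matsubaraFreq_mul_beta hβ.ne' i
  have hp := one_add_exp_shift_ne_zero hθ (nambuXi L μ kv)
  have hE := shift_sub_matsubaraFreq_ne_zero (M := M) hβ hθ (nambuXi L μ kv)
  rw [integral_freqKernel_mul_fermiTimeKernel _ _ _ τa hτb hω hp hE, mul_sum, mul_sum]
  refine sum_congr rfl fun i _ => ?_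
  have hβ' : (β : ℂ) ≠ 0 := by exact_mod_cast hβ.ne'
  have hL : ((L : ℝ) : ℂ) ≠ 0 := by exact_mod_cast (NeZero.ne L)
  have hden := matsubara_shift_den_ne_zero hβ hθ (nambuXi L μ kv) i
  rw [topWeight, shiftedFreeSymbol_eq_div β μ θ ((i, kv), σ) hden]
  dsimp only
  have hD : -Complex.I * ((matsubaraFreq β M i + θ : ℝ) : ℂ) + (nambuXi L μ kv : ℂ) =
      ((nambuXi L μ kv : ℂ) - (θ : ℂ) * Complex.I) - (matsubaraFreq β M i : ℂ) * Complex.I := by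
    push_cast; ring
  rw [hD]
  have hphase : Complex.exp (((vertexPhase L M β (i, kv) xa τa - vertexPhase L M β (i, kv) xb τb : ℝ) : ℂ) * Complex.I) =
      Complex.exp (((matsubaraFreq β M i * (τa - τb) : ℝ) : ℂ) * Complex.I) *
        (Complex.exp (((∑ l, latticeMomentum L kv l * ((xa l).val : ℝ) : ℝ) : ℂ) * Complex.I) *
          Complex.exp (-(((∑ l, latticeMomentum L kv l * ((xb l).val : ℝ) : ℝ) : ℂ) * Complex.I))) := by
    rw [← Complex.exp_add, ← Complex.exp_add]
    congr 1
    simp only [vertexPhase]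
    push_cast
    ring
  rw [hphase]
  have hsq : ((1 / (β * (L : ℝ) ^ 2) : ℝ) : ℂ) ^ 2 * (((β * (L : ℝ) ^ 2 : ℝ) : ℂ)) =
      ((1 / (L : ℝ) : ℝ) : ℂ) * ((1 / (L : ℝ) : ℝ) : ℂ) * (((1 / β : ℝ) : ℂ)) := by
    push_cast
    field_simp
  set D := (nambuXi L μ kv : ℂ) - (θ : ℂ) * Complex.I - (matsubaraFreq β M i : ℂ) * Complex.I
  calc ((1 / (β * (L : ℝ) ^ 2) : ℝ) : ℂ) ^ 2 *
        (Complex.exp (((matsubaraFreq β M i * (τa - τb) : ℝ) : ℂ) * Complex.I) *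
          (Complex.exp (((∑ l, latticeMomentum L kv l * ((xa l).val : ℝ) : ℝ) : ℂ) * Complex.I) *
            Complex.exp (-(((∑ l, latticeMomentum L kv l * ((xb l).val : ℝ) : ℝ) : ℂ) * Complex.I))) *
          (((fejerWeight M (matsubaraInt M i) : ℝ) : ℂ) * (((β * (L : ℝ) ^ 2 : ℝ) : ℂ) / D)))
      = (((1 / (β * (L : ℝ) ^ 2) : ℝ) : ℂ) ^ 2 * ((β * (L : ℝ) ^ 2 : ℝ) : ℂ)) *
          ((Complex.exp (((∑ l, latticeMomentum L kv l * ((xa l).val : ℝ) : ℝ) : ℂ) * Complex.I) *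
            Complex.exp (-(((∑ l, latticeMomentum L kv l * ((xb l).val : ℝ) : ℝ) : ℂ) * Complex.I))) *
          (((fejerWeight M (matsubaraInt M i) : ℝ) : ℂ) *
            (Complex.exp (((matsubaraFreq β M i * (τa - τb) : ℝ) : ℂ) * Complex.I) / D))) := by ring
    _ = _ := by rw [hsq]; ring

/-- **The Fejér-truncated propagator between grid points** (`(+,-)` entry of the pulled-back covariance with symbol `χ · p_θ`):
`[σ = σ'] ∫₀^β F_χ(τ_X - s) Σ_k⃗ L⁻² e^{ip⃗(x⃗_X - x⃗_Y)} K_β(ξ_k⃗ - iθ; s, τ_Y) ds`. [cite: PedraSalmhofer2008, §2 (2.8)-(2.10)] -/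
theorem gridSub_pullback_top_apply {β : ℝ} (hβ : 0 < β) {θ : ℝ} (hθ : |β * θ| ≤ Real.pi / 4) (μ : ℝ) {N : ℕ}
    (X Y : GridLeg (GridPoint L N)) (hX : X.2 = 0) (hY : Y.2 = 1) :
    ((gridSubMatrix L M β (fun p : GridPoint L N => p.2) (fun p => gridTime β N p.1)).transpose *
        normalCovariance L M (fun ks => ((topWeight L M ks.1 : ℝ) : ℂ) * shiftedFreeSymbol L M β μ θ ks) *
        gridSubMatrix L M β (fun p : GridPoint L N => p.2) (fun p => gridTime β N p.1)) X Y =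
      (if X.1.2 = Y.1.2 then 1 else 0) *
        ∫ s in (0:ℝ)..β, freqKernel β (matsubaraFreq β M) (fun i => ((fejerWeight M (matsubaraInt M i) : ℝ) : ℂ))
            (gridTime β N X.1.1.1 - s) *
          ∑ kv : TorusSite 2 L, ((1 / (L : ℝ) : ℝ) : ℂ) *
              Complex.exp (((∑ l, latticeMomentum L kv l * ((X.1.1.2 l).val : ℝ) : ℝ) : ℂ) * Complex.I) *
            (((1 / (L : ℝ) : ℝ) : ℂ) *
              Complex.exp (-(((∑ l, latticeMomentum L kv l * ((Y.1.1.2 l).val : ℝ) : ℝ) : ℂ) * Complex.I))) *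
            fermiTimeKernel β ((nambuXi L μ kv : ℂ) - (θ : ℂ) * Complex.I) s (gridTime β N Y.1.1.1) := by
  obtain ⟨⟨⟨ja, xa⟩, σa⟩, ca⟩ := X
  obtain ⟨⟨⟨jb, xb⟩, σb⟩, cb⟩ := Y
  simp only at hX hY
  subst hX
  subst hY
  have hτb : gridTime β N jb ∈ Icc 0 β := gridTime_mem_Icc hβ.le jb
  rw [gridSub_pullback_normalCovariance_apply_zero_one]
  dsimp only
  split_ifs with hσ
  · rw [one_mul, Fintype.sum_prod_type_right]
    set Fχ := freqKernel β (matsubaraFreq β M) (fun i => ((fejerWeight M (matsubaraInt M i) : ℝ) : ℂ)) with hFχ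
    set E : TorusSite 2 L → ℂ := fun kv => (nambuXi L μ kv : ℂ) - (θ : ℂ) * Complex.I with hEdef
    set c : TorusSite 2 L → ℂ := fun kv => ((1 / (L : ℝ) : ℝ) : ℂ) *
        Complex.exp (((∑ l, latticeMomentum L kv l * ((xa l).val : ℝ) : ℝ) : ℂ) * Complex.I) *
      (((1 / (L : ℝ) : ℝ) : ℂ) * Complex.exp (-(((∑ l, latticeMomentum L kv l * ((xb l).val : ℝ) : ℝ) : ℂ) * Complex.I))) with hc
    have hkv : ∀ kv : TorusSite 2 L,
        (∑ i : MatsubaraIdx M, ((1 / (β * (L : ℝ) ^ 2) : ℝ) : ℂ) ^ 2 *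
          (Complex.exp (((vertexPhase L M β (i, kv) xa (gridTime β N ja) - vertexPhase L M β (i, kv) xb (gridTime β N jb) : ℝ) : ℂ) *
              Complex.I) * (((topWeight L M (i, kv) : ℝ) : ℂ) * shiftedFreeSymbol L M β μ θ ((i, kv), σa)))) =
          ∫ s in (0:ℝ)..β, c kv * (Fχ (gridTime β N ja - s) * fermiTimeKernel β (E kv) s (gridTime β N jb)) := by
      intro kv
      rw [sum_freq_top_symbol_phase_eq_integral hβ hθ μ kv σa xa xb _ hτb, ← intervalIntegral.integral_const_mul]
    have hint : ∀ kv : TorusSite 2 L, IntervalIntegrable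
        (fun s => c kv * (Fχ (gridTime β N ja - s) * fermiTimeKernel β (E kv) s (gridTime β N jb))) volume 0 β := by
      intro kv
      refine IntervalIntegrable.const_mul ?_ _
      exact (intervalIntegrable_fermiTimeKernel (E kv) hτb).continuousOn_mul
        (((continuous_freqKernel _ _ _).comp (continuous_const.sub continuous_id)).continuousOn)
    rw [sum_congr rfl fun kv _ => hkv kv, ← intervalIntegral.integral_finsetSum fun kv _ => hint kv]
    refine intervalIntegral.integral_congr fun s _ => ?_
    rw [mul_sum]
    exact sum_congr rfl fun kv _ => by ring
  · rw [zero_mul]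

end Average

/-! ### The contraction of the pulled-back ultraviolet block: chronological part plus infrared Gram part -/

section Split

variable {L M : ℕ} [NeZero L]

omit [NeZero L] in
/-- `C_uv = C_χ - C_{ir}`: the UV symbol is the Fejér-truncated full symbol minus its infrared part (BGM (2.10)).
[cite: BenfattoGiulianiMastropietro2006, §2.2 (2.10)] -/
theorem hubbardCovUVShifted_eq_sub (β μ θ Λ₀ : ℝ) :
    hubbardCovUVShifted L M β μ θ Λ₀ =
      normalCovariance L M (fun ks => ((topWeight L M ks.1 : ℝ) : ℂ) * shiftedFreeSymbol L M β μ θ ks) -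
        normalCovariance L M
          (fun ks => ((1 - hubbardCutoffWeight L M β μ Λ₀ ks.1 : ℝ) : ℂ) * shiftedFreeSymbol L M β μ θ ks) := by
  ext X Y
  rw [hubbardCovUVShifted, Matrix.sub_apply, normalCovariance_apply, normalCovariance_apply, normalCovariance_apply]
  split_ifs <;> push_cast <;> ring

/-- The two-point function is additive in the covariance. [folklore] -/
private theorem contr_sub_apply {Γ : Type*} (A B : Matrix Γ Γ ℂ) (X Y : Γ) :
    contr ℂ (A - B) X Y = contr ℂ A X Y - contr ℂ B X Y := by
  simp only [contr_apply, Matrix.sub_apply]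
  ring

/-- For an antisymmetric covariance the two-point function is `-C(X, Y)`. [folklore] -/
private theorem contr_apply_of_transpose_eq_neg {Γ : Type*} {A : Matrix Γ Γ ℂ} (h : A.transpose = -A) (X Y : Γ) :
    contr ℂ A X Y = -A X Y := by
  have h1 : A Y X = -A X Y := by
    have := congrFun (congrFun h X) Y
    rwa [Matrix.transpose_apply, Matrix.neg_apply] at this
  rw [contr_apply, h1, Rat.smul_one_eq_cast]
  push_cast
  ring

end Split

/-! ### Finite-dimensional bookkeeping: the frozen rows and columns -/

section Sums

variable {L : ℕ} [NeZero L] {n : ℕ}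

/-- The real inner product of `ℝⁿ` in coordinates. [folklore] -/
private theorem real_inner_eq_sum_mul (u v : EuclideanSpace ℝ (Fin n)) : ⟪u, v⟫_ℝ = ∑ r, u r * v r := by
  rw [PiLp.inner_apply]
  simp [mul_comm]

/-- The norm of `ℝⁿ` in coordinates. [folklore] -/
private theorem norm_sq_eq_sum_sq (u : EuclideanSpace ℝ (Fin n)) : ‖u‖ ^ 2 = ∑ r, u r ^ 2 := by
  rw [EuclideanSpace.norm_eq, Real.sq_sqrt (sum_nonneg fun _ _ => by positivity)]
  simp

/-- The norm of `ℂ^ι` in coordinates. [folklore] -/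
private theorem complex_norm_sq_eq_sum {ι : Type*} [Fintype ι] (F : EuclideanSpace ℂ ι) : ‖F‖ ^ 2 = ∑ k, ‖F k‖ ^ 2 := by
  rw [EuclideanSpace.norm_eq, Real.sq_sqrt (sum_nonneg fun _ _ => by positivity)]

/-- `|z| · (z/|z|) = z`. [folklore] -/
private theorem norm_mul_div_norm_self (z : ℂ) : ((‖z‖ : ℝ) : ℂ) * (z / ((‖z‖ : ℝ) : ℂ)) = z := by
  by_cases hz : z = 0
  · simp [hz]
  · have h : ((‖z‖ : ℝ) : ℂ) ≠ 0 := by exact_mod_cast (norm_ne_zero_iff.2 hz)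
    field_simp

/-- `|z/|z|| ≤ 1`. [folklore] -/
private theorem norm_div_norm_le_one (z : ℂ) : ‖z / ((‖z‖ : ℝ) : ℂ)‖ ≤ 1 := by
  by_cases hz : z = 0
  · simp [hz]
  · rw [norm_div, Complex.norm_real, norm_norm, div_self (norm_ne_zero_iff.2 hz)]

/-- **The frozen chronological modes sum to the weighted propagator row**:
`Σ_{(k⃗,s,r)} F_a G_b K = -ph · ⟨u, v⟩ · [σ_a = σ_b] · Σ_k⃗ e_a(k⃗) e_b(k⃗) K(k⃗)`. [cite: PedraSalmhofer2008, Thm 2.4] -/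
theorem sum_frozen_modes_eq (ph : ℂ) (σa σb : Fin 2) (ea eb K : TorusSite 2 L → ℂ) (u v : EuclideanSpace ℝ (Fin n)) :
    ∑ m : (TorusSite 2 L × Fin 2) × Fin n,
        -(ph * ((if m.1.2 = σa then 1 else 0) * ea m.1.1) * ((u m.2 : ℝ) : ℂ)) *
          (((if m.1.2 = σb then 1 else 0) * eb m.1.1) * ((v m.2 : ℝ) : ℂ)) * K m.1.1 =
      -(ph * (((⟪u, v⟫_ℝ : ℝ) : ℂ) * ((if σa = σb then 1 else 0) * ∑ kv, ea kv * eb kv * K kv))) := by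
  rw [Fintype.sum_prod_type, real_inner_eq_sum_mul]
  push_cast
  have h1 : ∀ ks : TorusSite 2 L × Fin 2,
      (∑ r : Fin n, -(ph * ((if ks.2 = σa then 1 else 0) * ea ks.1) * ((u r : ℝ) : ℂ)) *
          (((if ks.2 = σb then 1 else 0) * eb ks.1) * ((v r : ℝ) : ℂ)) * K ks.1) =
        -(ph * ((if ks.2 = σa then 1 else 0) * ((if ks.2 = σb then 1 else 0) * (ea ks.1 * eb ks.1 * K ks.1)))) *
          ∑ r : Fin n, ((u r : ℝ) : ℂ) * ((v r : ℝ) : ℂ) := by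
    intro ks
    rw [mul_sum]
    exact sum_congr rfl fun r _ => by ring
  simp only [h1]
  rw [← sum_mul, Fintype.sum_prod_type]
  simp only [Fin.sum_univ_two, Fin.isValue]
  have h2 : ∀ kv : TorusSite 2 L,
      -(ph * ((if (0 : Fin 2) = σa then 1 else 0) * ((if (0 : Fin 2) = σb then 1 else 0) * (ea kv * eb kv * K kv)))) +
        -(ph * ((if (1 : Fin 2) = σa then 1 else 0) * ((if (1 : Fin 2) = σb then 1 else 0) * (ea kv * eb kv * K kv)))) =
      -(ph * (if σa = σb then 1 else 0)) * (ea kv * eb kv * K kv) := by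
    intro kv
    fin_cases σa <;> fin_cases σb <;> simp
  simp only [h2]
  rw [← mul_sum]
  ring

/-- **The infrared Gram modes sum to the weighted Gram entry**: `Σ_{(k,r)} P_a Q_b = -⟨u, v⟩ ⟪F, G⟫`. [cite: BenfattoGiulianiMastropietro2006, §2.8 (2.80)] -/
theorem sum_gram_modes_eq {ι : Type*} [Fintype ι] (F G : EuclideanSpace ℂ ι) (u v : EuclideanSpace ℝ (Fin n)) :
    ∑ m' : ι × Fin n, (-conj (F m'.1) * ((u m'.2 : ℝ) : ℂ)) * (G m'.1 * ((v m'.2 : ℝ) : ℂ)) =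
      -(((⟪u, v⟫_ℝ : ℝ) : ℂ) * ⟪F, G⟫_ℂ) := by
  rw [Fintype.sum_prod_type, real_inner_eq_sum_mul, PiLp.inner_apply]
  push_cast
  simp only [RCLike.inner_apply]
  have h1 : ∀ k : ι, (∑ r : Fin n, (-conj (F k) * ((u r : ℝ) : ℂ)) * (G k * ((v r : ℝ) : ℂ))) =
      (-(conj (F k) * G k)) * ∑ r : Fin n, ((u r : ℝ) : ℂ) * ((v r : ℝ) : ℂ) := by
    intro k
    rw [mul_sum]
    exact sum_congr rfl fun r _ => by ring
  simp only [h1]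
  rw [← sum_mul, sum_neg_distrib,
    show (∑ x, WithLp.ofLp G x * conj (WithLp.ofLp F x)) = ∑ x, conj (WithLp.ofLp F x) * WithLp.ofLp G x from
      sum_congr rfl fun x _ => mul_comm _ _]
  ring

/-- `Σ_{(k,r)} |g(k) w(r)|² = (Σ_k |g(k)|²)(Σ_r |w(r)|²)`. [folklore] -/
private theorem sum_norm_sq_prod_modes {ι ι' : Type*} [Fintype ι] [Fintype ι'] (g : ι → ℂ) (w : ι' → ℂ) :
    ∑ m : ι × ι', ‖g m.1 * w m.2‖ ^ 2 = (∑ k, ‖g k‖ ^ 2) * ∑ r, ‖w r‖ ^ 2 := by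
  rw [Fintype.sum_prod_type, sum_mul_sum]
  exact sum_congr rfl fun k _ => sum_congr rfl fun r _ => by rw [norm_mul, mul_pow]

/-- **A frozen chronological row has `ℓ²` norm at most one**: `Σ |ph · δ_{sσ} e(k⃗) u_r|² = |ph|² ‖u‖² ≤ 1` when
`|e(k⃗)|² = L⁻²` (`L²` momenta), `|ph| ≤ 1`, `‖u‖ ≤ 1`. [cite: PedraSalmhofer2008, Thm 2.4] -/
theorem sum_norm_sq_frozen_row_le (ph : ℂ) (hph : ‖ph‖ ≤ 1) (σa : Fin 2) (ea : TorusSite 2 L → ℂ)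
    (hea : ∀ kv, ‖ea kv‖ ^ 2 = 1 / (L : ℝ) ^ 2) (u : EuclideanSpace ℝ (Fin n)) (hu : ‖u‖ ≤ 1) :
    ∑ m : (TorusSite 2 L × Fin 2) × Fin n, ‖ph * ((if m.1.2 = σa then 1 else 0) * ea m.1.1) * ((u m.2 : ℝ) : ℂ)‖ ^ 2 ≤ 1 := by
  have h1 : ∀ m : (TorusSite 2 L × Fin 2) × Fin n,
      ‖ph * ((if m.1.2 = σa then 1 else 0) * ea m.1.1) * ((u m.2 : ℝ) : ℂ)‖ ^ 2 =
        ‖ph‖ ^ 2 * ((if m.1.2 = σa then 1 / (L : ℝ) ^ 2 else 0) * u m.2 ^ 2) := by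
    intro m
    rw [norm_mul, norm_mul, norm_mul, Complex.norm_real, Real.norm_eq_abs, mul_pow, mul_pow, mul_pow, sq_abs, hea]
    split_ifs
    · simp only [norm_one, one_pow, one_mul]
      ring
    · simp
  simp only [h1]
  rw [← mul_sum, Fintype.sum_prod_type]
  have h2 : ∀ ks : TorusSite 2 L × Fin 2, (∑ r : Fin n, (if ks.2 = σa then 1 / (L : ℝ) ^ 2 else 0) * u r ^ 2) =
      (if ks.2 = σa then 1 / (L : ℝ) ^ 2 else 0) * ‖u‖ ^ 2 := by
    intro ks; rw [← mul_sum, norm_sq_eq_sum_sq]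
  simp only [h2]
  rw [← sum_mul, Fintype.sum_prod_type]
  simp only [Finset.sum_ite_eq', Finset.mem_univ, if_true]
  rw [sum_const, card_univ, nsmul_eq_mul]
  have hcard : (Fintype.card (TorusSite 2 L) : ℝ) = (L : ℝ) ^ 2 := by
    rw [Fintype.card_pi, prod_const, ZMod.card, card_univ, Fintype.card_fin]; push_cast; ring
  rw [hcard]
  have hL : (L : ℝ) ≠ 0 := by exact_mod_cast NeZero.ne L
  rw [mul_one_div_cancel (pow_ne_zero 2 hL), one_mul]
  have hph2 : ‖ph‖ ^ 2 ≤ 1 := by nlinarith [norm_nonneg ph]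
  have hu2 : ‖u‖ ^ 2 ≤ 1 := by nlinarith [norm_nonneg u]
  exact mul_le_one₀ hph2 (sq_nonneg _) hu2

/-- **An infrared Gram row has `ℓ²` norm at most `κ`**: `Σ |conj F(k) u_r|² = ‖F‖² ‖u‖² ≤ κ²`. [cite: BenfattoGiulianiMastropietro2006, §2.8 (2.80)] -/
theorem sum_norm_sq_conj_gram_row_le {ι : Type*} [Fintype ι] (F : EuclideanSpace ℂ ι) {κ : ℝ} (hF : ‖F‖ ≤ κ)
    (u : EuclideanSpace ℝ (Fin n)) (hu : ‖u‖ ≤ 1) :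
    ∑ m' : ι × Fin n, ‖-conj (F m'.1) * ((u m'.2 : ℝ) : ℂ)‖ ^ 2 ≤ κ ^ 2 := by
  have h := sum_norm_sq_prod_modes (fun k => -conj (F k)) (fun r => ((u r : ℝ) : ℂ))
  dsimp only at h
  rw [h]
  simp only [norm_neg, Complex.norm_conj, Complex.norm_real, Real.norm_eq_abs, sq_abs]
  rw [← complex_norm_sq_eq_sum, ← norm_sq_eq_sum_sq]
  have hu2 : ‖u‖ ^ 2 ≤ 1 := by nlinarith [norm_nonneg u]
  calc ‖F‖ ^ 2 * ‖u‖ ^ 2 ≤ κ ^ 2 * 1 :=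
        mul_le_mul (pow_le_pow_left₀ (norm_nonneg _) hF 2) hu2 (sq_nonneg _) (sq_nonneg _)
    _ = κ ^ 2 := mul_one _

/-- The same for a column: `Σ |G(k) v_r|² ≤ κ²`. [cite: BenfattoGiulianiMastropietro2006, §2.8 (2.80)] -/
theorem sum_norm_sq_gram_col_le {ι : Type*} [Fintype ι] (G : EuclideanSpace ℂ ι) {κ : ℝ} (hG : ‖G‖ ≤ κ)
    (v : EuclideanSpace ℝ (Fin n)) (hv : ‖v‖ ≤ 1) :
    ∑ m' : ι × Fin n, ‖G m'.1 * ((v m'.2 : ℝ) : ℂ)‖ ^ 2 ≤ κ ^ 2 := by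
  have h := sum_norm_sq_prod_modes (fun k => G k) (fun r => ((v r : ℝ) : ℂ))
  dsimp only at h
  rw [h]
  simp only [Complex.norm_real, Real.norm_eq_abs, sq_abs]
  rw [← complex_norm_sq_eq_sum, ← norm_sq_eq_sum_sq]
  have hv2 : ‖v‖ ^ 2 ≤ 1 := by nlinarith [norm_nonneg v]
  calc ‖G‖ ^ 2 * ‖v‖ ^ 2 ≤ κ ^ 2 * 1 :=
        mul_le_mul (pow_le_pow_left₀ (norm_nonneg _) hG 2) hv2 (sq_nonneg _) (sq_nonneg _)
    _ = κ ^ 2 := mul_one _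

end Sums

/-! ### The determinant bound -/

section Main

variable {L M : ℕ} [NeZero L]

/-- **The Pedra–Salmhofer determinant bound for the ultraviolet block on the time grid**: for `0 < β`, `|βθ| ≤ π/4`, `0 < M` and any
bound `κ` of the Gram vectors of the infrared part `(1 - w_{Λ₀}) p_θ`, the pulled-back UV covariance `Sᵀ C_uv S` of the grid fields
(`S = hubbardGridSub`, charge-`0` legs as rows) satisfies `IsDetBoundedR q (Sᵀ C_uv S) (2 √(1 + κ²))` — uniformly in `M`, `N`, `L`:
`|det [⟨u_i,u'_j⟩ contr(X̄_i, Y_j)]| ≤ 4^a (1 + κ²)^a`. [cite: PedraSalmhofer2008, Thm 2.4] -/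
theorem isDetBoundedR_gridSub_hubbardCovUVShifted {β : ℝ} (hβ : 0 < β) (μ : ℝ) {θ : ℝ} (hθ : |β * θ| ≤ Real.pi / 4)
    (hM : 0 < M) (N : ℕ) (Λ₀ : ℝ) {κ : ℝ}
    (hF : ∀ X : GridLeg (GridPoint L N), ‖gridGramF L M β (fun p : GridPoint L N => p.2) (fun p => gridTime β N p.1)
        (fun ks => ((1 - hubbardCutoffWeight L M β μ Λ₀ ks.1 : ℝ) : ℂ) * shiftedFreeSymbol L M β μ θ ks) X‖ ≤ κ)
    (hG : ∀ Y : GridLeg (GridPoint L N), ‖gridGramG L M β (fun p : GridPoint L N => p.2) (fun p => gridTime β N p.1)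
        (fun ks => ((1 - hubbardCutoffWeight L M β μ Λ₀ ks.1 : ℝ) : ℂ) * shiftedFreeSymbol L M β μ θ ks) Y‖ ≤ κ) :
    IsDetBoundedR (fun X : GridLeg (GridPoint L N) => decide (X.2 = 0))
      ((hubbardGridSub L M β N).transpose * hubbardCovUVShifted L M β μ θ Λ₀ * hubbardGridSub L M β N)
      (2 * Real.sqrt (1 + κ ^ 2)) := by
  classical
  intro n a u u' hu hu' Xb Xu hb hub
  have hXb : ∀ i, (Xb i).2 = 0 := fun i => of_decide_eq_true (hb i)
  have hXu : ∀ j, (Xu j).2 = 1 := fun j => Fin.eq_one_of_ne_zero _ (of_decide_eq_false (hub j))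
  have hτc : ∀ j, gridTime β N (Xu j).1.1.1 ∈ Icc 0 β := fun j => gridTime_mem_Icc hβ.le _
  simp only [hubbardGridSub]
  -- the Fejér kernel, the weights and the phases of the rows
  set Fχ := freqKernel β (matsubaraFreq β M) (fun i => ((fejerWeight M (matsubaraInt M i) : ℝ) : ℂ)) with hFχ
  set φ : Fin a → ℝ → ℂ := fun i s => ((‖Fχ (gridTime β N (Xb i).1.1.1 - s)‖ : ℝ) : ℂ) with hφ
  set ph : Fin a → ℝ → ℂ := fun i s =>
    Fχ (gridTime β N (Xb i).1.1.1 - s) / ((‖Fχ (gridTime β N (Xb i).1.1.1 - s)‖ : ℝ) : ℂ) with hph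
  have hφph : ∀ i s, φ i s * ph i s = Fχ (gridTime β N (Xb i).1.1.1 - s) := fun i s => norm_mul_div_norm_self _
  have hph1 : ∀ i s, ‖ph i s‖ ≤ 1 := fun i s => norm_div_norm_le_one _
  -- the momentum sum of chronological kernels between row `i` and column `j`
  set Ksum : Fin a → Fin a → ℝ → ℂ := fun i j s =>
    ∑ kv : TorusSite 2 L, ((1 / (L : ℝ) : ℝ) : ℂ) *
        Complex.exp (((∑ l, latticeMomentum L kv l * (((Xb i).1.1.2 l).val : ℝ) : ℝ) : ℂ) * Complex.I) *
      (((1 / (L : ℝ) : ℝ) : ℂ) *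
        Complex.exp (-(((∑ l, latticeMomentum L kv l * (((Xu j).1.1.2 l).val : ℝ) : ℝ) : ℂ) * Complex.I))) *
      fermiTimeKernel β ((nambuXi L μ kv : ℂ) - (θ : ℂ) * Complex.I) s (gridTime β N (Xu j).1.1.1) with hKsum
  -- the frozen data
  set Ff : Fin a → ℝ → (TorusSite 2 L × Fin 2) × Fin n → ℂ := fun i s m =>
    -(ph i s * ((if m.1.2 = (Xb i).1.2 then 1 else 0) * (((1 / (L : ℝ) : ℝ) : ℂ) *
        Complex.exp (((∑ l, latticeMomentum L m.1.1 l * (((Xb i).1.1.2 l).val : ℝ) : ℝ) : ℂ) * Complex.I))) *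
      ((u i m.2 : ℝ) : ℂ)) with hFf
  set Gf : Fin a → (TorusSite 2 L × Fin 2) × Fin n → ℂ := fun j m =>
    ((if m.1.2 = (Xu j).1.2 then 1 else 0) * (((1 / (L : ℝ) : ℝ) : ℂ) *
        Complex.exp (-(((∑ l, latticeMomentum L m.1.1 l * (((Xu j).1.1.2 l).val : ℝ) : ℝ) : ℂ) * Complex.I)))) *
      ((u' j m.2 : ℝ) : ℂ) with hGf
  set Pf : Fin a → (FreqMomentum L M × Fin 2) × Fin n → ℂ := fun i m' =>
    -conj (gridGramF L M β (fun p : GridPoint L N => p.2) (fun p => gridTime β N p.1)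
        (fun ks => ((1 - hubbardCutoffWeight L M β μ Λ₀ ks.1 : ℝ) : ℂ) * shiftedFreeSymbol L M β μ θ ks) (Xb i) m'.1) *
      ((u i m'.2 : ℝ) : ℂ) with hPf
  set Qf : Fin a → (FreqMomentum L M × Fin 2) × Fin n → ℂ := fun j m' =>
    gridGramG L M β (fun p : GridPoint L N => p.2) (fun p => gridTime β N p.1)
        (fun ks => ((1 - hubbardCutoffWeight L M β μ Λ₀ ks.1 : ℝ) : ℂ) * shiftedFreeSymbol L M β μ θ ks) (Xu j) m'.1 *
      ((u' j m'.2 : ℝ) : ℂ) with hQf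
  set 𝔄 : Fin a → Fin a → ℝ → ℂ := fun i j s =>
    (∑ m, Ff i s m * Gf j m *
        fermiTimeKernel β ((nambuXi L μ m.1.1 : ℂ) - (θ : ℂ) * Complex.I) ((Set.projIcc 0 β hβ.le s : ℝ))
          (gridTime β N (Xu j).1.1.1)) +
      ∑ m', Pf i m' * Qf j m' with h𝔄
  -- (1) the frozen entries in closed form
  have h𝔄eq : ∀ i j s, 𝔄 i j s =
      -(ph i s * (((⟪u i, u' j⟫_ℝ : ℝ) : ℂ) * ((if (Xb i).1.2 = (Xu j).1.2 then 1 else 0) *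
          Ksum i j (Set.projIcc 0 β hβ.le s : ℝ)))) -
        ((⟪u i, u' j⟫_ℝ : ℝ) : ℂ) *
          ⟪gridGramF L M β (fun p : GridPoint L N => p.2) (fun p => gridTime β N p.1)
              (fun ks => ((1 - hubbardCutoffWeight L M β μ Λ₀ ks.1 : ℝ) : ℂ) * shiftedFreeSymbol L M β μ θ ks) (Xb i),
            gridGramG L M β (fun p : GridPoint L N => p.2) (fun p => gridTime β N p.1)
              (fun ks => ((1 - hubbardCutoffWeight L M β μ Λ₀ ks.1 : ℝ) : ℂ) * shiftedFreeSymbol L M β μ θ ks) (Xu j)⟫_ℂ := by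
    intro i j s
    simp only [h𝔄, hFf, hGf, hPf, hQf, hKsum]
    rw [sum_frozen_modes_eq (ph i s) (Xb i).1.2 (Xu j).1.2
        (fun kv => ((1 / (L : ℝ) : ℝ) : ℂ) *
          Complex.exp (((∑ l, latticeMomentum L kv l * (((Xb i).1.1.2 l).val : ℝ) : ℝ) : ℂ) * Complex.I))
        (fun kv => ((1 / (L : ℝ) : ℝ) : ℂ) *
          Complex.exp (-(((∑ l, latticeMomentum L kv l * (((Xu j).1.1.2 l).val : ℝ) : ℝ) : ℂ) * Complex.I)))
        (fun kv => fermiTimeKernel β ((nambuXi L μ kv : ℂ) - (θ : ℂ) * Complex.I) ((Set.projIcc 0 β hβ.le s : ℝ))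
          (gridTime β N (Xu j).1.1.1)) (u i) (u' j),
      sum_gram_modes_eq]
    ring
  -- (2) the weighted integrand, pointwise
  have hφ𝔄 : ∀ i j s, φ i s * 𝔄 i j s =
      -(((⟪u i, u' j⟫_ℝ : ℝ) : ℂ) * (if (Xb i).1.2 = (Xu j).1.2 then 1 else 0)) *
          (Fχ (gridTime β N (Xb i).1.1.1 - s) * Ksum i j (Set.projIcc 0 β hβ.le s : ℝ)) +
        (-(((⟪u i, u' j⟫_ℝ : ℝ) : ℂ) *
          ⟪gridGramF L M β (fun p : GridPoint L N => p.2) (fun p => gridTime β N p.1)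
              (fun ks => ((1 - hubbardCutoffWeight L M β μ Λ₀ ks.1 : ℝ) : ℂ) * shiftedFreeSymbol L M β μ θ ks) (Xb i),
            gridGramG L M β (fun p : GridPoint L N => p.2) (fun p => gridTime β N p.1)
              (fun ks => ((1 - hubbardCutoffWeight L M β μ Λ₀ ks.1 : ℝ) : ℂ) * shiftedFreeSymbol L M β μ θ ks) (Xu j)⟫_ℂ)) *
          φ i s := by
    intro i j s
    rw [h𝔄eq, ← hφph i s]
    ring
  -- (3) continuity and integrability
  have hFcont : ∀ i, Continuous fun s : ℝ => Fχ (gridTime β N (Xb i).1.1.1 - s) := fun i =>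
    (continuous_freqKernel _ _ _).comp (continuous_const.sub continuous_id)
  have hφcont : ∀ i, Continuous (φ i) := fun i =>
    Complex.continuous_ofReal.comp (continuous_norm.comp (hFcont i))
  have hIφ : ∀ i, Integrable (φ i) (volume.restrict (Ioc 0 β)) := fun i =>
    ((hφcont i).intervalIntegrable 0 β).1
  have hKint : ∀ i j, IntervalIntegrable (fun s => Ksum i j s) volume 0 β := by
    intro i j
    rw [intervalIntegrable_iff_integrableOn_Ioc_of_le hβ.le]
    simp only [hKsum]
    exact integrable_finsetSum _ fun kv _ =>
      (((intervalIntegrable_fermiTimeKernel _ (hτc j)).const_mul _).1 :)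
  have hFKint : ∀ i j, IntegrableOn (fun s => Fχ (gridTime β N (Xb i).1.1.1 - s) * Ksum i j s) (Ioc 0 β) := fun i j =>
    ((hKint i j).continuousOn_mul (hFcont i).continuousOn).1
  have hprojeq : ∀ i j, EqOn (fun s => Fχ (gridTime β N (Xb i).1.1.1 - s) * Ksum i j (Set.projIcc 0 β hβ.le s : ℝ))
      (fun s => Fχ (gridTime β N (Xb i).1.1.1 - s) * Ksum i j s) (Ioc 0 β) := by
    intro i j s hs
    simp only [Set.projIcc_of_mem hβ.le ⟨hs.1.le, hs.2⟩]
  have hFKint' : ∀ i j, IntegrableOn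
      (fun s => Fχ (gridTime β N (Xb i).1.1.1 - s) * Ksum i j (Set.projIcc 0 β hβ.le s : ℝ)) (Ioc 0 β) := fun i j =>
    (hFKint i j).congr_fun (hprojeq i j).symm measurableSet_Ioc
  have hIφ𝔄 : ∀ i j, Integrable (fun s => φ i s * 𝔄 i j s) (volume.restrict (Ioc 0 β)) := by
    intro i j
    rw [show (fun s => φ i s * 𝔄 i j s) = _ from funext (hφ𝔄 i j)]
    exact ((hFKint' i j).const_mul _).add ((hIφ i).const_mul _)
  -- (4) the weights integrate to one
  have hφone : ∀ i, ∫ s in Ioc 0 β, ‖φ i s‖ = 1 := by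
    intro i
    simp only [hφ, Complex.norm_real, norm_norm]
    rw [← intervalIntegral.integral_of_le hβ.le]
    exact integral_norm_freqKernel_fejer_sub hβ hM _
  have hφoneC : ∀ i, ∫ s in Ioc 0 β, φ i s = 1 := by
    intro i
    simp only [hφ]
    rw [integral_complex_ofReal, ← intervalIntegral.integral_of_le hβ.le, integral_norm_freqKernel_fejer_sub hβ hM,
      Complex.ofReal_one]
  -- (5) the entry identity
  have hentry : ∀ i j, ((⟪u i, u' j⟫_ℝ : ℝ) : ℂ) *
      contr ℂ ((gridSubMatrix L M β (fun p : GridPoint L N => p.2) (fun p => gridTime β N p.1)).transpose *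
        hubbardCovUVShifted L M β μ θ Λ₀ *
        gridSubMatrix L M β (fun p : GridPoint L N => p.2) (fun p => gridTime β N p.1)) (Xb i) (Xu j) =
      ∫ s in Ioc 0 β, φ i s * 𝔄 i j s := by
    intro i j
    rw [hubbardCovUVShifted_eq_sub, Matrix.mul_sub, Matrix.sub_mul, contr_sub_apply,
      contr_apply_of_transpose_eq_neg (gridSub_pullback_normalCovariance_transpose β _ _
        (fun ks => ((topWeight L M ks.1 : ℝ) : ℂ) * shiftedFreeSymbol L M β μ θ ks)) (Xb i) (Xu j),
      contr_gridSub_pullback_normalCovariance_eq_inner β _ _ _ (hXb i) (hXu j),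
      gridSub_pullback_top_apply hβ hθ μ (Xb i) (Xu j) (hXb i) (hXu j)]
    rw [show (fun s => φ i s * 𝔄 i j s) = _ from funext (hφ𝔄 i j), integral_add ((hFKint' i j).const_mul _)
      ((hIφ i).const_mul _), integral_const_mul, integral_const_mul, setIntegral_congr_fun measurableSet_Ioc (hprojeq i j),
      ← intervalIntegral.integral_of_le hβ.le, hφoneC i]
    simp only [hKsum]
    ring
  -- (6) the frozen determinant bound, uniformly in the times
  have hFrow : ∀ i s, ∑ m, ‖Ff i s m‖ ^ 2 ≤ 1 := by
    intro i s
    simp only [hFf, norm_neg]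
    refine sum_norm_sq_frozen_row_le (ph i s) (hph1 i s) (Xb i).1.2
      (fun kv => ((1 / (L : ℝ) : ℝ) : ℂ) *
        Complex.exp (((∑ l, latticeMomentum L kv l * (((Xb i).1.1.2 l).val : ℝ) : ℝ) : ℂ) * Complex.I))
      (fun kv => ?_) (u i) (hu i)
    rw [norm_mul, Complex.norm_exp_ofReal_mul_I, mul_one, Complex.norm_real, Real.norm_eq_abs, sq_abs, one_div, inv_pow,
      one_div]
  have hGrow : ∀ j, ∑ m, ‖Gf j m‖ ^ 2 ≤ 1 := by
    intro j
    have h := sum_norm_sq_frozen_row_le (L := L) 1 (by simp) (Xu j).1.2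
      (fun kv => ((1 / (L : ℝ) : ℝ) : ℂ) *
        Complex.exp (-(((∑ l, latticeMomentum L kv l * (((Xu j).1.1.2 l).val : ℝ) : ℝ) : ℂ) * Complex.I)))
      (fun kv => ?_) (u' j) (hu' j)
    · simpa only [hGf, one_mul] using h
    · rw [norm_mul, Complex.norm_exp, Complex.norm_real, Real.norm_eq_abs]
      simp
  have hProw : ∀ i, ∑ m', ‖Pf i m'‖ ^ 2 ≤ κ ^ 2 := fun i => by
    simp only [hPf]
    exact sum_norm_sq_conj_gram_row_le _ (hF _) (u i) (hu i)
  have hQrow : ∀ j, ∑ m', ‖Qf j m'‖ ^ 2 ≤ κ ^ 2 := fun j => by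
    simp only [hQf]
    exact sum_norm_sq_gram_col_le _ (hG _) (u' j) (hu' j)
  have hdet : ∀ x : Fin a → ℝ, ‖(Matrix.of fun i j : Fin a => 𝔄 i j (x i)).det‖ ≤
      4 ^ a * ((∏ _i : Fin a, Real.sqrt (1 + κ ^ 2)) * ∏ _j : Fin a, Real.sqrt (1 + κ ^ 2)) := by
    intro x
    simp only [h𝔄]
    refine (norm_det_fermiTimeKernel_add_gram_le hθ (fun m : (TorusSite 2 L × Fin 2) × Fin n => nambuXi L μ m.1.1)
      (fun i => (Set.projIcc 0 β hβ.le (x i) : ℝ)) (fun j => gridTime β N (Xu j).1.1.1)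
      (fun i => (Set.projIcc 0 β hβ.le (x i)).2) hτc (fun i => Ff i (x i)) Gf Pf Qf).trans ?_
    refine mul_le_mul_of_nonneg_left (mul_le_mul (prod_le_prod (fun _ _ => Real.sqrt_nonneg _) fun i _ =>
      Real.sqrt_le_sqrt (add_le_add (hFrow i (x i)) (hProw i))) (prod_le_prod (fun _ _ => Real.sqrt_nonneg _) fun j _ =>
      Real.sqrt_le_sqrt (add_le_add (hGrow j) (hQrow j))) (prod_nonneg fun _ _ => Real.sqrt_nonneg _)
      (prod_nonneg fun _ _ => Real.sqrt_nonneg _)) (by positivity)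
  -- (7) assemble
  have hfinal : ‖(Matrix.of fun i j : Fin a => ∫ s in Ioc 0 β, φ i s * 𝔄 i j s).det‖ ≤
      (2 * Real.sqrt (1 + κ ^ 2)) ^ a * (2 * Real.sqrt (1 + κ ^ 2)) ^ a := by
    refine (Literature.Analysis.Matrix.norm_det_row_integral_le (volume.restrict (Ioc 0 β)) φ 𝔄 hIφ hIφ𝔄 hdet).trans ?_
    rw [prod_eq_one fun i _ => hφone i, mul_one, prod_const, card_univ, Fintype.card_fin, mul_pow,
      show (4 : ℝ) ^ a = 2 ^ a * 2 ^ a by rw [← mul_pow]; norm_num]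
    exact le_of_eq (by ring)
  have hmat : (Matrix.of fun i j : Fin a => ((⟪u i, u' j⟫_ℝ : ℝ) : ℂ) *
      contr ℂ ((gridSubMatrix L M β (fun p : GridPoint L N => p.2) (fun p => gridTime β N p.1)).transpose *
        hubbardCovUVShifted L M β μ θ Λ₀ *
        gridSubMatrix L M β (fun p : GridPoint L N => p.2) (fun p => gridTime β N p.1)) (Xb i) (Xu j)) =
      Matrix.of fun i j : Fin a => ∫ s in Ioc 0 β, φ i s * 𝔄 i j s := by
    ext i j
    exact hentry i j
  have h := hmat ▸ hfinal
  exact h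

end Main

end Literature.MathematicalPhysics.QuantumLattice

end
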